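import Summits.Ventures.CertifiedManyBodySolver.Downfold.EmeryCuprateSigns
import HarnessLib

/-!
# The cluster-CAP seam: an AFFINE three-band cap `e(θ, ρ) ≤ Σ_a θ_a T_a` (fourteen cluster traces) is a box word with a CLOSED-FORM bound —
# no vertex enumeration — and the two-sided WINDOW order form; La₂CuO₄ instance

Venture CertifiedManyBodySolver, cell `pub/hubbard-downfold` (S1 = ROUTER), seat hubbard-downfold-mod-4 (S1/S2 Emery seam); namespace
`Summit.Ventures.CertifiedManyBodySolver.Downfold`. The floor half of the three-band window is the cluster-floor seam (`EmeryClusterFloorSeam`,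
`…Free`, `EmeryCuprateSigns`: four CuO₄-plus certificates ⇒ the typed floor word). For the CAP half, hubbard-box-p1 g15's producer law
`EmeryThreeBandClusterTrialCap` (p625321; physical-sites variant `EmeryThreeBandPhysClusterTrialCap`) gives, from ONE even cluster density matrix `ρ₀`
on an aligned `Cu_{ab}O_{2ab}` block (dummies empty, `Re tr(Nρ₀) = 4abρ`), an AFFINE cap
`emeryEnergyDensity θ ρ ≤ |block|⁻¹ Σ_a θ_a Re tr(D_{a,block} ρ₀)` at EVERY `θ` (`emeryEnergyDensity_le_sum_clusterTraces`). `S2SeamEmeryCaps.holdsOn_emeryEnergyCap`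
would transport such a cap by checking 64 vertices; but an affine function of `θ` restricted to the physical line is LINEAR in the six box coordinates,
so its maximum over the delivered six-box is a closed form. THIS FILE:

* §1 `lineCoeff s T : Fin 6 → ℝ` — the six line coefficients of the fourteen traces `T` for sign pattern `s`
  (`(T₀+T₁+T₂+T₃, Σ_k s_k T_{4+k}, T₈, T₉+T₁₀, T₁₁, T₁₂+T₁₃)`), `sum_emeryLine_mul_eq` (`Σ_a (emeryLine s q)_a T_a = Σ_k q_k · lineCoeff s T k`),
  `affineCapBound s T lo hi = Σ_k max(lo_k·c_k, hi_k·c_k)` and `sum_mul_lineCoeff_le_affineCapBound` (the linear form is below it on `Set.Icc lo hi`);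
* §2 THE CAP DOOR `holdsOn_emeryEnergyCap_of_affineCap`: `(∀ θ, e(θ, ρ) ≤ Σ_a θ_a T_a)` ⇒ the box word `p ↦ e(emeryLine s (emeryLineCoords εp p), ρ) ≤
  affineCapBound s T (emeryLo …) (emeryHi …)` on any typed Emery box; `affineCap_of_scaled` (box-p1's `|block|⁻¹ · Σ` shape ⇒ the `Σ θ_a T_a` shape);
* §3 THE WINDOW ORDER FORM `holdsOn_emeryEnergyWindow_of_cuO4Certificates_and_affineCap`: four tilted CuO₄-plus floor certificates + one affine cap ⇒
  `m ≤ e ≤ affineCapBound` on the typed box (ρ ∈ [0, 3/2]; nothing else assumed);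
* §4 La₂CuO₄ (#18): `la214v122x_affineCapBound` (the closed form on the exact companion's six-box `[1.29,1.52]×[0.46,0.66]×[1.7,4]×{0}×[4.83,10.5]×[3.39,6.13]`),
  `emeryBoxLa214v122_cuprate_energyCap54_of_affineCap` and **`emeryBoxLa214v122_cuprate_energyWindow54`** (s = `cuprateSigns`, ρ = 5/4).

Everything PROVED (0 sorry); definitions with bodies: `lineCoeff`, `affineCapBound`. HONEST SCOPE: doors — no certificate, no number; the cap producer's
fourteen traces are S2's data (a rational pure state in a fixed sector makes them rationals); SCREENING-GRADE box ends; cluster-product caps are crude at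
small blocks (box-p1's float orientation: first La₂CuO₄ windows ≈ 0.8–0.95 eV/CuO₂ wide).
-/

noncomputable section

namespace Summit.Ventures.CertifiedManyBodySolver.Downfold

open NonemptyInterval Matrix Finset Literature.Probability.LatticeModels
open Literature.MathematicalPhysics.QuantumLattice Literature.Computation.Certificates
open scoped BigOperators ComplexOrder

/-! ## §1 Line coefficients of an affine cap and its closed-form maximum over a six-box -/

/-- **The six line coefficients** of fourteen direction data `T` for sign pattern `s`: the affine form `Σ_a θ_a T_a` restricted to `θ = emeryLine s q`
is `q₀(T₀+T₁+T₂+T₃) + q₁ Σ_k s_k T_{4+k} + q₂ T₈ + q₃ (T₉+T₁₀) + q₄ T₁₁ + q₅ (T₁₂+T₁₃)`. [cite: PavariniEtAl2001, eq. (1)] -/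
def lineCoeff (s : Fin 4 → ℝ) (T : Fin 14 → ℝ) : Fin 6 → ℝ :=
  ![T 0 + T 1 + T 2 + T 3, s 0 * T 4 + s 1 * T 5 + s 2 * T 6 + s 3 * T 7, T 8, T 9 + T 10, T 11, T 12 + T 13]

/-- **The affine form along the physical line is linear in the six coordinates.** [cite: PavariniEtAl2001, eq. (1)] -/
theorem sum_emeryLine_mul_eq (s : Fin 4 → ℝ) (T : Fin 14 → ℝ) (q : Fin 6 → ℝ) :
    ∑ a, emeryLine s q a * T a = ∑ k, q k * lineCoeff s T k := by
  simp only [emeryLine, lineCoeff, LinearMap.coe_mk, AddHom.coe_mk, Fin.sum_univ_succ, Fin.sum_univ_zero]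
  simp
  ring

/-- **The closed-form maximum of a linear form over a box**: `Σ_k max(lo_k·c_k, hi_k·c_k)`. [folklore] -/
def affineCapBound (s : Fin 4 → ℝ) (T : Fin 14 → ℝ) (lo hi : Fin 6 → ℝ) : ℝ :=
  ∑ k, max (lo k * lineCoeff s T k) (hi k * lineCoeff s T k)

/-- One coordinate: `lo ≤ x ≤ hi ⇒ x·c ≤ max(lo·c, hi·c)` (whatever the sign of `c`). [folklore] -/
theorem mul_le_max_mul_of_mem {lo hi x c : ℝ} (hlo : lo ≤ x) (hhi : x ≤ hi) : x * c ≤ max (lo * c) (hi * c) := by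
  rcases le_total 0 c with hc | hc
  · exact (mul_le_mul_of_nonneg_right hhi hc).trans (le_max_right _ _)
  · exact (mul_le_mul_of_nonpos_right hlo hc).trans (le_max_left _ _)

/-- **The linear form is below the closed-form bound on the box.** [folklore] -/
theorem sum_mul_lineCoeff_le_affineCapBound (s : Fin 4 → ℝ) (T : Fin 14 → ℝ) {lo hi q : Fin 6 → ℝ} (hq : q ∈ Set.Icc lo hi) :
    ∑ k, q k * lineCoeff s T k ≤ affineCapBound s T lo hi :=
  Finset.sum_le_sum fun k _ => mul_le_max_mul_of_mem (hq.1 k) (hq.2 k)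

/-- **Line form of an affine cap**: `(∀ θ, e(θ,ρ) ≤ Σ_a θ_a T_a)` ⇒ `e(emeryLine s q, ρ) ≤ affineCapBound s T lo hi` on `Set.Icc lo hi`. [cite: Ruelle1969, §3.3] -/
theorem emeryEnergyDensity_line_le_affineCapBound {ρ : ℝ} {T : Fin 14 → ℝ} (hcap : ∀ θ : Fin 14 → ℝ, emeryEnergyDensity θ ρ ≤ ∑ a, θ a * T a)
    (s : Fin 4 → ℝ) {lo hi q : Fin 6 → ℝ} (hq : q ∈ Set.Icc lo hi) :
    emeryEnergyDensity (emeryLine s q) ρ ≤ affineCapBound s T lo hi := by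
  refine (hcap _).trans ?_
  rw [sum_emeryLine_mul_eq]
  exact sum_mul_lineCoeff_le_affineCapBound s T hq

/-- **Rescaling helper**: a cap in box-p1's shape `c · Σ_a θ_a t_a` is a cap in the shape `Σ_a θ_a (c·t_a)`. [folklore] -/
theorem affineCap_of_scaled {ρ c : ℝ} {t : Fin 14 → ℝ} (h : ∀ θ : Fin 14 → ℝ, emeryEnergyDensity θ ρ ≤ c * ∑ a, θ a * t a) :
    ∀ θ : Fin 14 → ℝ, emeryEnergyDensity θ ρ ≤ ∑ a, θ a * (c * t a) := by
  intro θ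
  refine (h θ).trans (le_of_eq ?_)
  rw [Finset.mul_sum]
  exact Finset.sum_congr rfl fun a _ => by ring

/-! ## §2 The cap door on a typed Emery box -/

/-- **THE CAP DOOR (closed form).** An affine three-band cap `e(θ, ρ) ≤ Σ_a θ_a T_a` valid at every `θ` (e.g. box-p1's cluster-trace cap with
`T_a = |block|⁻¹ Re tr(D_{a,block} ρ₀)`) gives, on any typed Emery box with the five seam entries and any sign pattern `s`, the box word
`p ↦ e(emeryLine s (emeryLineCoords εp p), ρ) ≤ affineCapBound s T (emeryLo εp …) (emeryHi εp …)`. [cite: Ruelle1969, §3.3] -/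
theorem holdsOn_emeryEnergyCap_of_affineCap {E : EmeryBox} {eA eB eD eUd eUp : Entry} {εp : ℚ}
    (hA : E .tpd = some eA) (hB : E .tpp = some eB) (hD : E .DeltaPd = some eD)
    (hUd : E .Udd = some eUd) (hUp : E .Upp = some eUp) (s : Fin 4 → ℝ) {ρ : ℝ} {T : Fin 14 → ℝ}
    (hcap : ∀ θ : Fin 14 → ℝ, emeryEnergyDensity θ ρ ≤ ∑ a, θ a * T a) :
    HoldsOn (fun p : EmeryCoord → ℝ => emeryEnergyDensity (emeryLine s (emeryLineCoords (εp : ℝ) p)) ρ ≤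
      affineCapBound s T (emeryLo εp eA eB eD eUd eUp) (emeryHi εp eA eB eD eUd eUp)) E :=
  holdsOn_of_forall_emeryLineBox hA hB hD hUd hUp (fun _ hq => emeryEnergyDensity_line_le_affineCapBound hcap s hq)

/-! ## §3 The two-sided WINDOW order form -/

/-- **THE WINDOW ORDER FORM.** Four tilted CuO₄-plus floor certificates (`EmeryClusterFloorSeamFree`) and one affine cap give the two-sided word
`m ≤ e(emeryLine s (emeryLineCoords εp p), ρ) ≤ affineCapBound s T lo hi` on a typed Emery box, for every `ρ ∈ [0, 3/2]` — nothing else assumed.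
[cite: Anderson1951, eq. (2)] [cite: Ruelle1969, §3.3] -/
theorem holdsOn_emeryEnergyWindow_of_cuO4Certificates_and_affineCap {E : EmeryBox} {eA eB eD eUd eUp : Entry} {εp : ℚ}
    (hA : E .tpd = some eA) (hB : E .tpp = some eB) (hD : E .DeltaPd = some eD)
    (hUd : E .Udd = some eUd) (hUp : E .Upp = some eUp) (s : Fin 4 → ℝ) {ρ : ℝ} (hρ0 : 0 ≤ ρ) (hρ1 : ρ ≤ 3 / 2) {M : ℝ} (hM : 0 < M)
    (G : Fin 4 → FermionOp emeryCuO4Window)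
    (hG0 : ∀ i, ∀ ω' : InfVolFermionState 2, ω'.IsPeriodic liebPeriods → (ω'.expect emeryCuO4Window (G i)).re = 0)
    (μ q₀ : Fin 4 → ℝ)
    (hq : ∀ i : Fin 4, ((⟨fun X => (uniformPeriodicWeight liebPeriods emeryCuO4Window M X : ℂ) •
        (emeryInteraction (emeryLine s (lowerCorner (emeryLo εp eA eB eD eUd eUp) (emeryHi εp eA eB eD eUd eUp) i) +
          μ i • levelDir)).Φ X⟩ : FermionInteraction 2).localHamiltonian emeryCuO4Window + G i -
        (q₀ i : ℂ) • (1 : FermionOp emeryCuO4Window)).PosSemidef)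
    {m : ℝ} (hm : ∀ i : Fin 4, m ≤ q₀ i / (4 * M) - μ i * ρ)
    {T : Fin 14 → ℝ} (hcap : ∀ θ : Fin 14 → ℝ, emeryEnergyDensity θ ρ ≤ ∑ a, θ a * T a) :
    HoldsOn (fun p : EmeryCoord → ℝ =>
      m ≤ emeryEnergyDensity (emeryLine s (emeryLineCoords (εp : ℝ) p)) ρ ∧
        emeryEnergyDensity (emeryLine s (emeryLineCoords (εp : ℝ) p)) ρ ≤
          affineCapBound s T (emeryLo εp eA eB eD eUd eUp) (emeryHi εp eA eB eD eUd eUp)) E :=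
  fun p hp => ⟨holdsOn_emeryEnergyFloor_of_cuO4Certificates_free hA hB hD hUd hUp s hρ0 hρ1 hM G hG0 μ q₀ hq hm p hp,
    holdsOn_emeryEnergyCap_of_affineCap hA hB hD hUd hUp s hcap p hp⟩

/-! ## §4 La₂CuO₄ (#18) -/

/-- **The closed-form cap bound on La₂CuO₄'s exact companion** (six-box `[129/100, 38/25] × [23/50, 33/50] × [17/10, 4] × {0} × [483/100, 21/2] ×
[339/100, 613/100]`, εp = 0): `affineCapBound s T lo hi` with those ends. [folklore] -/
theorem la214v122x_affineCapBound (s : Fin 4 → ℝ) (T : Fin 14 → ℝ) :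
    affineCapBound s T (emeryLo 0 la214Emery_tpd la214Emery_tpp la214Emery_Delta la214Emery_Udd_v122 la214Emery_Upp_exact)
        (emeryHi 0 la214Emery_tpd la214Emery_tpp la214Emery_Delta la214Emery_Udd_v122 la214Emery_Upp_exact) =
      max (129/100 * lineCoeff s T 0) (38/25 * lineCoeff s T 0) + max (23/50 * lineCoeff s T 1) (33/50 * lineCoeff s T 1) +
        max (17/10 * lineCoeff s T 2) (4 * lineCoeff s T 2) + max (0 * lineCoeff s T 3) (0 * lineCoeff s T 3) +
        max (483/100 * lineCoeff s T 4) (21/2 * lineCoeff s T 4) + max (339/100 * lineCoeff s T 5) (613/100 * lineCoeff s T 5) := by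
  rw [la214v122x_emeryLo, la214v122x_emeryHi, affineCapBound]
  simp [Fin.sum_univ_succ]
  ring

/-- **La₂CuO₄ CAP ORDER**: one affine cap (fourteen traces `T`) at the cuprate pattern ⇒ the cap word on the companion of record `emeryBoxLa214v122`
(via the exact companion; ρ = 5/4). [cite: Ruelle1969, §3.3] -/
theorem emeryBoxLa214v122_cuprate_energyCap54_of_affineCap {T : Fin 14 → ℝ}
    (hcap : ∀ θ : Fin 14 → ℝ, emeryEnergyDensity θ (5 / 4) ≤ ∑ a, θ a * T a) :
    HoldsOn (fun p : EmeryCoord → ℝ => emeryEnergyDensity (emeryLine cuprateSigns (emeryLineCoords 0 p)) (5 / 4) ≤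
      affineCapBound cuprateSigns T (emeryLo 0 la214Emery_tpd la214Emery_tpp la214Emery_Delta la214Emery_Udd_v122 la214Emery_Upp_exact)
        (emeryHi 0 la214Emery_tpd la214Emery_tpp la214Emery_Delta la214Emery_Udd_v122 la214Emery_Upp_exact)) emeryBoxLa214v122 := by
  have h := holdsOn_emeryEnergyCap_of_affineCap (E := emeryBoxLa214v122x) (εp := 0) (eA := la214Emery_tpd) (eB := la214Emery_tpp)
    (eD := la214Emery_Delta) (eUd := la214Emery_Udd_v122) (eUp := la214Emery_Upp_exact) emeryBoxLa214v122x_entries.1 emeryBoxLa214v122x_entries.2.1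
    emeryBoxLa214v122x_entries.2.2.1 emeryBoxLa214v122x_entries.2.2.2.1 emeryBoxLa214v122x_entries.2.2.2.2.1 cuprateSigns hcap
  have h' := holdsOn_emeryBoxLa214v122_of_v122x h
  simpa using h'

/-- **THE La₂CuO₄ WINDOW ORDER, FINAL FORM.** Four tilted CuO₄-plus certificates at `emeryLine cuprateSigns (la214v122xCorner i) + μ i·levelDir` and one
affine cap (fourteen cluster traces `T`) give `m ≤ e ≤ affineCapBound` on the companion of record at ρ = 5/4 — nothing else assumed.
[cite: Anderson1951, eq. (2)] [cite: Ruelle1969, §3.3] -/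
theorem emeryBoxLa214v122_cuprate_energyWindow54 {M : ℝ} (hM : 0 < M)
    (G : Fin 4 → FermionOp emeryCuO4Window)
    (hG0 : ∀ i, ∀ ω' : InfVolFermionState 2, ω'.IsPeriodic liebPeriods → (ω'.expect emeryCuO4Window (G i)).re = 0)
    (μ q₀ : Fin 4 → ℝ)
    (hq : ∀ i : Fin 4, ((⟨fun X => (uniformPeriodicWeight liebPeriods emeryCuO4Window M X : ℂ) •
        (emeryInteraction (emeryLine cuprateSigns (la214v122xCorner i) + μ i • levelDir)).Φ X⟩ : FermionInteraction 2).localHamiltonian emeryCuO4Window +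
        G i - (q₀ i : ℂ) • (1 : FermionOp emeryCuO4Window)).PosSemidef)
    {m : ℝ} (hm : ∀ i : Fin 4, m ≤ q₀ i / (4 * M) - μ i * (5 / 4))
    {T : Fin 14 → ℝ} (hcap : ∀ θ : Fin 14 → ℝ, emeryEnergyDensity θ (5 / 4) ≤ ∑ a, θ a * T a) :
    HoldsOn (fun p : EmeryCoord → ℝ =>
      m ≤ emeryEnergyDensity (emeryLine cuprateSigns (emeryLineCoords 0 p)) (5 / 4) ∧
        emeryEnergyDensity (emeryLine cuprateSigns (emeryLineCoords 0 p)) (5 / 4) ≤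
          affineCapBound cuprateSigns T (emeryLo 0 la214Emery_tpd la214Emery_tpp la214Emery_Delta la214Emery_Udd_v122 la214Emery_Upp_exact)
            (emeryHi 0 la214Emery_tpd la214Emery_tpp la214Emery_Delta la214Emery_Udd_v122 la214Emery_Upp_exact)) emeryBoxLa214v122 :=
  fun p hp => ⟨emeryBoxLa214v122_cuprate_energyFloor54_of_cuO4Certificates hM G hG0 μ q₀ hq hm p hp,
    emeryBoxLa214v122_cuprate_energyCap54_of_affineCap hcap p hp⟩

end Summit.Ventures.CertifiedManyBodySolver.Downfold

end
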